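import Literature.NumberTheory.LFunctions.KMVCentralValueSquaredAFE
import HarnessLib

/-!
# KMV's cut-off `W` (real form `KMV2000.cutoffW`): basic properties, and the vanishing of the
# `k = 0` summand `KMV2000.afeSqTerm` on the axes

Source: E. Kowalski, P. Michel, J. VanderKam, J. reine angew. Math. 526 (2000), (21)–(22) p. 12
[held: paper:doi-10-1515-crll-2000-074]: `W(y) = (1/2πi)∫_{(3)} Γ(1+t)² y^{−t} dt/t` «decays faster
than any negative power of `y`». For the tree's closed real form `cutoffW y = ∫_0^∞ e^{−u−y/u} du`
(statement file `KMVCentralValueSquaredAFE`, p624193) this file PROVES: `W(0) = 1`; the integrand is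
continuous, dominated by `e^{−u}` and integrable on `(0,∞)` for `y ≥ 0`; `0 ≤ W`, `W` antitone on
`[0,∞)`, `W ≤ 1`; the explicit decay `W(y) ≤ 2e^{−√y}` (AM–GM `u + y/u ≥ u/2 + √y`); and
`λ_f(0) = 0`, so `afeSqTerm q f` vanishes on `{0} × ℕ ∪ ℕ × {0}` (the printed sum is over `n₁,n₂ ≥ 1`).
Proofs only (no definitions, no named facts). Cell landau-siegel / ls-inputs, H-AFE (K-INPUTS-7 (3)).
-/

noncomputable section

open scoped MatrixGroups Real
open CongruenceSubgroup Complex Set MeasureTheory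
open Literature.NumberTheory.EllipticCurves.ModularForms

namespace Literature.NumberTheory.LFunctions.KMV2000

/-! ### `cutoffW` -/

/-- `W(0) = ∫_0^∞ e^{−u} du = 1`. [cite: KowalskiMichelVanderKam2000, (21) p. 12] -/
theorem cutoffW_zero : cutoffW 0 = 1 := by
  simp only [cutoffW, zero_div, sub_zero]
  exact integral_exp_neg_Ioi_zero

/-- `e^{−u}` is integrable on `(0, ∞)` (Mathlib `exp_neg_integrableOn_Ioi` at rate `1`; the
majorant of the integrand of (21)'s `W`). [cite: KowalskiMichelVanderKam2000, (21) p. 12] -/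
theorem integrableOn_exp_neg_Ioi : IntegrableOn (fun u : ℝ ↦ Real.exp (-u)) (Ioi 0) := by
  simpa using exp_neg_integrableOn_Ioi 0 one_pos

/-- For `y ≥ 0`, `u > 0`: the integrand of `W` (21) is dominated by `e^{−u}`.
[cite: KowalskiMichelVanderKam2000, (21) p. 12] -/
theorem exp_neg_sub_div_le {y u : ℝ} (hy : 0 ≤ y) (hu : 0 < u) :
    Real.exp (-u - y / u) ≤ Real.exp (-u) := by
  have : 0 ≤ y / u := div_nonneg hy hu.le
  exact Real.exp_le_exp.mpr (by linarith)

/-- The integrand `u ↦ e^{−u − y/u}` of `W` (21) is continuous on `(0, ∞)`.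
[cite: KowalskiMichelVanderKam2000, (21) p. 12] -/
theorem continuousOn_exp_neg_sub_div (y : ℝ) :
    ContinuousOn (fun u : ℝ ↦ Real.exp (-u - y / u)) (Ioi 0) := by
  refine Real.continuous_exp.comp_continuousOn ?_
  exact (continuousOn_id.neg).sub (continuousOn_const.div continuousOn_id fun u hu ↦ ne_of_gt hu)

/-- For `y ≥ 0` the integrand of `W` (21) is integrable on `(0, ∞)` (so `cutoffW y` is an honest
integral, not a junk value). [cite: KowalskiMichelVanderKam2000, (21) p. 12] -/
theorem integrableOn_exp_neg_sub_div {y : ℝ} (hy : 0 ≤ y) :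
    IntegrableOn (fun u : ℝ ↦ Real.exp (-u - y / u)) (Ioi 0) := by
  refine Integrable.mono' integrableOn_exp_neg_Ioi
    ((continuousOn_exp_neg_sub_div y).aestronglyMeasurable measurableSet_Ioi) ?_
  refine (ae_restrict_iff' measurableSet_Ioi).mpr (ae_of_all _ fun u hu ↦ ?_)
  rw [Real.norm_of_nonneg (Real.exp_pos _).le]
  exact exp_neg_sub_div_le hy hu

/-- `W(y) ≥ 0` for every `y`. [cite: KowalskiMichelVanderKam2000, (21) p. 12] -/
theorem cutoffW_nonneg (y : ℝ) : 0 ≤ cutoffW y :=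
  integral_nonneg fun _ ↦ (Real.exp_pos _).le

/-- `W` is non-increasing on `[0, ∞)`: `0 ≤ y ≤ y' ⇒ W(y') ≤ W(y)`.
[cite: KowalskiMichelVanderKam2000, (21) p. 12] -/
theorem cutoffW_antitoneOn : AntitoneOn cutoffW (Ici 0) := by
  intro y hy y' hy' hyy'
  refine setIntegral_mono_on (integrableOn_exp_neg_sub_div hy') (integrableOn_exp_neg_sub_div hy)
    measurableSet_Ioi fun u hu ↦ Real.exp_le_exp.mpr ?_
  have : y / u ≤ y' / u := div_le_div_of_nonneg_right hyy' (le_of_lt hu)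
  linarith

/-- `W(y) ≤ 1` for `y ≥ 0`. [cite: KowalskiMichelVanderKam2000, (21) p. 12] -/
theorem cutoffW_le_one {y : ℝ} (hy : 0 ≤ y) : cutoffW y ≤ 1 := by
  rw [← cutoffW_zero]
  exact cutoffW_antitoneOn (le_refl (0 : ℝ)) hy hy

/-- AM–GM in the form used for the decay (22) of `W`: `√y ≤ u/2 + y/u` for `u > 0`, `y ≥ 0`
(`u/2 + y/u − √y = ((u − √y)² + y)/(2u)`). [cite: KowalskiMichelVanderKam2000, (22) p. 12] -/
theorem sqrt_le_half_add_div {y u : ℝ} (hy : 0 ≤ y) (hu : 0 < u) :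
    Real.sqrt y ≤ u / 2 + y / u := by
  rw [div_add_div _ _ two_ne_zero hu.ne', le_div_iff₀ (by positivity)]
  nlinarith [sq_nonneg (u - Real.sqrt y), Real.sq_sqrt hy, Real.sqrt_nonneg y]

/-- **Decay of `W`** («decays faster than any negative power of `y`», (22)):
`W(y) ≤ 2 e^{−√y}` for `y ≥ 0` (pointwise `e^{−u−y/u} ≤ e^{−√y} e^{−u/2}`).
[cite: KowalskiMichelVanderKam2000, (22) p. 12] -/
theorem cutoffW_le_two_mul_exp_neg_sqrt {y : ℝ} (hy : 0 ≤ y) :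
    cutoffW y ≤ 2 * Real.exp (-Real.sqrt y) := by
  have hpt : ∀ u ∈ Ioi (0 : ℝ),
      Real.exp (-u - y / u) ≤ Real.exp (-Real.sqrt y) * Real.exp (-(1 / 2) * u) := by
    intro u hu
    rw [← Real.exp_add]
    exact Real.exp_le_exp.mpr (by linarith [sqrt_le_half_add_div hy hu])
  have hint : IntegrableOn (fun u : ℝ ↦ Real.exp (-Real.sqrt y) * Real.exp (-(1 / 2) * u))
      (Ioi 0) := (exp_neg_integrableOn_Ioi 0 (by norm_num : (0 : ℝ) < 1 / 2)).const_mul _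
  calc cutoffW y ≤ ∫ u in Ioi (0 : ℝ), Real.exp (-Real.sqrt y) * Real.exp (-(1 / 2) * u) :=
        setIntegral_mono_on (integrableOn_exp_neg_sub_div hy) hint measurableSet_Ioi hpt
    _ = 2 * Real.exp (-Real.sqrt y) := by
        rw [integral_const_mul, integral_exp_mul_Ioi (by norm_num : (-(1 / 2) : ℝ) < 0)]
        simp
        ring

/-! ### The summand on the axes -/

section SummandAPI

variable (q : ℕ)

/-- `λ_f(0) = 0` in weight `2` (the factor `0^{−1/2}` is `0` in Mathlib; Iwaniec–Kowalski §14.10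
defines `λ_f(n)` for `n ≥ 1` only). [cite: IwaniecKowalski2004, §14.10 (display before (14.59))] -/
theorem heckeLambda_zero (f : CuspForm (Gamma0 q) 2) : GL2Family.heckeLambda f 0 = 0 := by
  rw [GL2Family.heckeLambda, Nat.cast_zero, Complex.zero_cpow, mul_zero]
  norm_num

/-- The summand of (21) vanishes on the axis `n₁ = 0` (the printed sum is over `n₁, n₂ ≥ 1`).
[cite: KowalskiMichelVanderKam2000, (21) p. 12] -/
theorem afeSqTerm_of_fst_eq_zero (f : CuspForm (Gamma0 q) 2) (n₂ : ℕ) :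
    afeSqTerm q f (0, n₂) = 0 := by
  simp [afeSqTerm, heckeLambda_zero]

/-- The summand of (21) vanishes on the axis `n₂ = 0` (the printed sum is over `n₁, n₂ ≥ 1`).
[cite: KowalskiMichelVanderKam2000, (21) p. 12] -/
theorem afeSqTerm_of_snd_eq_zero (f : CuspForm (Gamma0 q) 2) (n₁ : ℕ) :
    afeSqTerm q f (n₁, 0) = 0 := by
  simp [afeSqTerm, heckeLambda_zero]

end SummandAPI

end Literature.NumberTheory.LFunctions.KMV2000

end
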